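import Summits.QuantumFields.Balaban3D.Proofs.TorusBalls
import Literature.MathematicalPhysics.QuantumFieldTheory.Balaban1983to89.B3Taylor310LocalRemainder
import HarnessLib

/-!
# Route `UnitScaleTilt`, crux K1 «MinimiserStabilityRegPr» (stmt-QuantumFields-19200), route-R E′ path (α′), (E1-b)-cov ∕ (N-cov) near-field transplant — FLAT-CONV letters, FILE 1:
# RADIAL LATTICE SUMS ON THE TORUS OF RECORD.  For any finite set of sites `S` in the `tdist`-annulus `M ≤ tdist(·,y) ≤ N` and any profile `f` antitone on `[M, N]`, the
# LAYER-CAKE identity `Σ_{z∈S} f(tdist z y) = #S·f(N) + Σ_{t=M}^{N−1} (f t − f(t+1))·#{z ∈ S : tdist z y ≤ t}` and the ball count `#{tdist ≤ t} ≤ (2(t+1))^d` give every radial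
# power sum: in `d = 3`, `Σ r⁻¹ ≤ 128N²`, `Σ r⁻² ≤ 192N`, `Σ r⁻³ ≤ 64 + 192·Σ_{t<N} t⁻¹`, `Σ r⁻⁴ ≤ 576∕M`, `Σ r⁻⁵ ≤ 704∕M²` — the engine of the torus-Green CONVOLUTION bounds

Cell `ym3-torus`, D-0154 (3c) twin-width seat `ym-routeR-w3` (gen 6); «FLAT-CONV — MINE» (bus 2026-08-28T22:10Z) on routeR-w6 g6's LOCATE-PCOV2 v1.2 §5 «NEW FLAT LETTERS: torus-Green CONVOLUTION bounds
against `r⁻²`∕`r⁻³` densities in a `3ℓ`-ball».  THEOREMS ONLY (0 `def`, 0 `sorry`); `--supports stmt-QuantumFields-19200`, count-neutral.  YM₃ on T³ is a ladder rung (R3), not the Clay problem;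
nothing here claims the stub, the crux, d = 4 or the gap.

WHAT IS PROVED (ns `…Theorems.Prop7TorusRadialSums`; torus `T^{(j)}` of the record, `Site.tdist`).
* §1 `card_ball_le_real` (✓ `TorusBalls.card_torusBall_le` in `ℝ`), `eq_add_sum_Ico_sub` (telescoping), ★★ `sum_radial_eq_layer` (the layer-cake IDENTITY), ★★ `sum_radial_le_of_antitone`
  (`Σ_{z∈S} f(tdist z y) ≤ (2(N+1))^d·f N + Σ_{t∈[M,N)} (f t − f(t+1))·(2(t+1))^d` for `f` antitone on `[M,N]`, `0 ≤ f N`).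
* §2 `inv_pow_sub_inv_pow_succ_le` (`t⁻ˢ − (t+1)⁻ˢ ≤ s·t⁻ˢ⁻¹`), `ball_factor_le` (`(2(t+1))³ ≤ 64t³` for `t ≥ 1`), ★ `sum_radial_inv_pow_le` (d = 3: `Σ_{z∈S} r⁻ˢ ≤ 64·N^{3−s}… + 64s·Σ_{t∈[M,N)} t^{2−s}`
  in the exact form `≤ 64·N³·(N^s)⁻¹ + 64·s·Σ t³·(t^{s+1})⁻¹`).
* §3 (d = 3, `1 ≤ M ≤ N`, `S ⊆ {M ≤ tdist(·,y) ≤ N}`) ★★ `sum_inv_tdist_le` (`≤ 128N²`), `sum_inv_tdist_sq_le` (`≤ 192N`), `sum_inv_tdist_cube_le` (`≤ 64 + 192·Σ_{t∈[M,N)} t⁻¹`),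
  `sum_inv_tdist_pow_four_le` (`≤ 576∕M`), `sum_inv_tdist_pow_five_le` (`≤ 704∕M²`).
HONEST SCOPE.  Counting only (no Green function appears); the three-region convolution bounds and their kernel instances are FILE 2.  Constants crude and ours.

References: G. F. Lawler, V. Limic, *Random Walk: A Modern Introduction*, CUP 2010, §6.3 [LawlerLimic2010] (orientation only); T. Bałaban, CMP 95 (1984) 17–40 [Balaban1984PropagatorsI]
((1.17)–(1.18) p.20, lattice geometry).
-/

set_option autoImplicit false

noncomputable section

open scoped BigOperators
open Finset

namespace Summit.QuantumFields.YangMills.Theorems.Prop7TorusRadialSums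

open Literature.MathematicalPhysics.QuantumFieldTheory.Balaban1983to89
open Summit.QuantumFields.Balaban3D.Proofs.TorusBalls (card_torusBall_le)
open B3Taylor310LocalRemainder (tdist_comm)

variable {P : Params} {j : ℕ}

/-! ## §1 The layer-cake engine -/

/-- Ball count, real form: `#{z : tdist z y ≤ t} ≤ (2(t+1))^d`. [folklore] -/
theorem card_ball_le_real (y : Site P j) (t : ℕ) :
    (((univ : Finset (Site P j)).filter fun z => Site.tdist z y ≤ t).card : ℝ) ≤ (2 * ((t : ℝ) + 1)) ^ P.d := by
  classical
  have h := card_torusBall_le y t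
  have e : ((univ : Finset (Site P j)).filter fun z => Site.tdist z y ≤ t) = ((univ : Finset (Site P j)).filter fun z => Site.tdist y z ≤ t) := by
    refine Finset.filter_congr fun z _ => ?_
    rw [tdist_comm]
  rw [e]
  exact_mod_cast h

/-- Telescoping: `f r = f N + Σ_{t ∈ [r, N)} (f t − f (t+1))` for `r ≤ N`. [folklore] -/
theorem eq_add_sum_Ico_sub (f : ℕ → ℝ) {r N : ℕ} (h : r ≤ N) : f r = f N + ∑ t ∈ Ico r N, (f t - f (t + 1)) := by
  induction N, h using Nat.le_induction with
  | base => simp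
  | succ N hN ih =>
      rw [Finset.sum_Ico_succ_top hN, ← add_assoc, add_comm (f (N + 1)), add_assoc, add_comm (f (N+1)), ← add_assoc]
      rw [ih]
      ring

/-- ★★ **THE LAYER-CAKE IDENTITY**: for a finite set `S` of sites with `M ≤ tdist(z,y) ≤ N` on `S` and any `f : ℕ → ℝ`:
`Σ_{z∈S} f(tdist z y) = #S·f N + Σ_{t ∈ [M,N)} (f t − f(t+1))·#{z ∈ S : tdist z y ≤ t}`. [folklore] -/
theorem sum_radial_eq_layer (S : Finset (Site P j)) (y : Site P j) (f : ℕ → ℝ) {M N : ℕ}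
    (hS : ∀ z ∈ S, M ≤ Site.tdist z y ∧ Site.tdist z y ≤ N) :
    ∑ z ∈ S, f (Site.tdist z y) = (S.card : ℝ) * f N + ∑ t ∈ Ico M N, (f t - f (t + 1)) * ((S.filter fun z => Site.tdist z y ≤ t).card : ℝ) := by
  classical
  have h1 : ∀ z ∈ S, f (Site.tdist z y) = f N + ∑ t ∈ Ico M N, (if Site.tdist z y ≤ t then (f t - f (t + 1)) else 0) := by
    intro z hz
    rw [eq_add_sum_Ico_sub f (hS z hz).2]
    congr 1
    rw [← Finset.sum_filter]
    refine Finset.sum_congr ?_ fun _ _ => rfl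
    ext t
    simp only [Finset.mem_Ico, Finset.mem_filter]
    constructor
    · rintro ⟨h1, h2⟩; exact ⟨⟨(hS z hz).1.trans h1, h2⟩, h1⟩
    · rintro ⟨⟨_, h2⟩, h3⟩; exact ⟨h3, h2⟩
  rw [Finset.sum_congr rfl h1, Finset.sum_add_distrib, Finset.sum_const, nsmul_eq_mul, Finset.sum_comm]
  congr 1
  refine Finset.sum_congr rfl fun t _ => ?_
  rw [← Finset.sum_filter, Finset.sum_const, nsmul_eq_mul, mul_comm]

/-- ★★ **THE ENGINE BOUND**: `S ⊆ {M ≤ tdist(·,y) ≤ N}`, `f` antitone on `[M, N]` (`f(t+1) ≤ f t` for `M ≤ t < N`), `0 ≤ f N` ⇒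
`Σ_{z∈S} f(tdist z y) ≤ (2(N+1))^d·f N + Σ_{t∈[M,N)} (f t − f(t+1))·(2(t+1))^d`. [folklore] -/
theorem sum_radial_le_of_antitone (S : Finset (Site P j)) (y : Site P j) (f : ℕ → ℝ) {M N : ℕ}
    (hS : ∀ z ∈ S, M ≤ Site.tdist z y ∧ Site.tdist z y ≤ N) (hf : ∀ t, M ≤ t → t < N → f (t + 1) ≤ f t) (hfN : 0 ≤ f N) :
    ∑ z ∈ S, f (Site.tdist z y) ≤ (2 * ((N : ℝ) + 1)) ^ P.d * f N + ∑ t ∈ Ico M N, (f t - f (t + 1)) * (2 * ((t : ℝ) + 1)) ^ P.d := by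
  classical
  rw [sum_radial_eq_layer S y f hS]
  have hcardS : (S.card : ℝ) ≤ (2 * ((N : ℝ) + 1)) ^ P.d := by
    refine le_trans ?_ (card_ball_le_real y N)
    exact_mod_cast Finset.card_le_card fun z hz => Finset.mem_filter.mpr ⟨Finset.mem_univ _, (hS z hz).2⟩
  refine add_le_add (mul_le_mul_of_nonneg_right hcardS hfN) (Finset.sum_le_sum fun t ht => ?_)
  rw [Finset.mem_Ico] at ht
  have hΔ : 0 ≤ f t - f (t + 1) := sub_nonneg.mpr (hf t ht.1 ht.2)
  refine mul_le_mul_of_nonneg_left (le_trans ?_ (card_ball_le_real y t)) hΔ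
  exact_mod_cast Finset.card_le_card fun z hz => by
    rw [Finset.mem_filter] at hz ⊢
    exact ⟨Finset.mem_univ _, hz.2⟩

/-! ## §2 Power profiles in `d = 3` -/

/-- `t⁻ˢ − (t+1)⁻ˢ ≤ s·t⁻⁽ˢ⁺¹⁾` for `t ≥ 1` (mean-value inequality for `u ↦ u^s`). [folklore] -/
theorem inv_pow_sub_inv_pow_succ_le {t : ℝ} (ht : 1 ≤ t) (s : ℕ) :
    (t ^ s)⁻¹ - ((t + 1) ^ s)⁻¹ ≤ s * (t ^ (s + 1))⁻¹ := by
  have ht0 : 0 < t := by linarith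
  have ht1 : 0 < t + 1 := by linarith
  have hts : 0 < t ^ s := pow_pos ht0 s
  have hts1 : 0 < (t + 1) ^ s := pow_pos ht1 s
  have hts2 : 0 < t ^ (s + 1) := pow_pos ht0 (s + 1)
  -- `(t+1)^s − t^s ≤ s (t+1)^{s-1} ≤ s (t+1)^s / t`… we use the cruder `(t+1)^s - t^s ≤ s·(t+1)^(s-1)·1` via the binomial mean value
  have key : (t + 1) ^ s - t ^ s ≤ s * (t + 1) ^ s / t := by
    -- `(t+1)^s - t^s = Σ_{i<s} (t+1)^i t^{s-1-i} ≤ s (t+1)^{s-1} ≤ s (t+1)^s / t`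
    have h1 : (t + 1) ^ s - t ^ s = (∑ i ∈ Finset.range s, (t + 1) ^ i * t ^ (s - 1 - i)) * ((t + 1) - t) := (geom_sum₂_mul (t + 1) t s).symm
    rw [h1, show (t + 1) - t = 1 by ring, mul_one]
    have h2 : ∀ i ∈ Finset.range s, (t + 1) ^ i * t ^ (s - 1 - i) ≤ (t + 1) ^ s / t := by
      intro i hi
      rw [Finset.mem_range] at hi
      rw [le_div_iff₀ ht0]
      have e : (t + 1) ^ i * t ^ (s - 1 - i) * t = (t + 1) ^ i * t ^ (s - i) := by
        rw [mul_assoc, ← pow_succ, show s - 1 - i + 1 = s - i by omega]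
      rw [e]
      calc (t + 1) ^ i * t ^ (s - i) ≤ (t + 1) ^ i * (t + 1) ^ (s - i) :=
            mul_le_mul_of_nonneg_left (pow_le_pow_left₀ ht0.le (by linarith) _) (pow_nonneg ht1.le _)
        _ = (t + 1) ^ s := by rw [← pow_add, show i + (s - i) = s by omega]
    calc ∑ i ∈ Finset.range s, (t + 1) ^ i * t ^ (s - 1 - i) ≤ ∑ _i ∈ Finset.range s, (t + 1) ^ s / t := Finset.sum_le_sum h2
      _ = s * (t + 1) ^ s / t := by rw [Finset.sum_const, Finset.card_range, nsmul_eq_mul]; ring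
  rw [inv_sub_inv hts.ne' hts1.ne', div_le_iff₀ (mul_pos hts hts1)]
  calc (t + 1) ^ s - t ^ s ≤ s * (t + 1) ^ s / t := key
    _ = s * (t ^ (s + 1))⁻¹ * (t ^ s * (t + 1) ^ s) := by
        field_simp
        ring

/-- `(2(t+1))^3 ≤ 64·t^3` for `t ≥ 1`. [folklore] -/
theorem ball_factor_le {t : ℝ} (ht : 1 ≤ t) : (2 * (t + 1)) ^ 3 ≤ 64 * t ^ 3 := by
  have h : 2 * (t + 1) ≤ 4 * t := by linarith
  have h0 : 0 ≤ 2 * (t + 1) := by linarith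
  calc (2 * (t + 1)) ^ 3 ≤ (4 * t) ^ 3 := pow_le_pow_left₀ h0 h 3
    _ = 64 * t ^ 3 := by ring

/-- ★ **RADIAL INVERSE-POWER SUM, d = 3**: `S ⊆ {M ≤ tdist(·,y) ≤ N}`, `1 ≤ M ≤ N` ⇒
`Σ_{z∈S} (tdist z y)⁻ˢ ≤ 64·N³·(N^s)⁻¹ + 64·s·Σ_{t∈[M,N)} t³·(t^{s+1})⁻¹`. [folklore] -/
theorem sum_radial_inv_pow_le (hd : P.d = 3) (S : Finset (Site P j)) (y : Site P j) (s : ℕ) {M N : ℕ} (hM : 1 ≤ M) (hMN : M ≤ N)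
    (hS : ∀ z ∈ S, M ≤ Site.tdist z y ∧ Site.tdist z y ≤ N) :
    ∑ z ∈ S, (((Site.tdist z y : ℕ) : ℝ) ^ s)⁻¹
      ≤ 64 * (N : ℝ) ^ 3 * (((N : ℝ)) ^ s)⁻¹ + 64 * s * ∑ t ∈ Ico M N, ((t : ℝ) ^ 3 * (((t : ℝ)) ^ (s + 1))⁻¹) := by
  have hN1 : (1 : ℝ) ≤ N := by exact_mod_cast hM.trans hMN
  have h := sum_radial_le_of_antitone S y (fun t => (((t : ℕ) : ℝ) ^ s)⁻¹) hS
    (fun t hMt _ => by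
      have ht1 : (1 : ℝ) ≤ t := by exact_mod_cast hM.trans hMt
      push_cast
      exact inv_anti₀ (pow_pos (by linarith) s) (pow_le_pow_left₀ (by linarith) (by linarith) s))
    (by positivity)
  refine h.trans (add_le_add ?_ ?_)
  · rw [hd]
    have := ball_factor_le hN1
    have h0 : 0 ≤ (((N : ℝ)) ^ s)⁻¹ := by positivity
    nlinarith
  · rw [hd, Finset.mul_sum]
    refine Finset.sum_le_sum fun t ht => ?_
    rw [Finset.mem_Ico] at ht
    have ht1 : (1 : ℝ) ≤ t := by exact_mod_cast hM.trans ht.1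
    have h1 := inv_pow_sub_inv_pow_succ_le ht1 s
    have h2 := ball_factor_le ht1
    have h3 : 0 ≤ (s : ℝ) * ((t : ℝ) ^ (s + 1))⁻¹ := by positivity
    have h4 : 0 ≤ (2 * ((t : ℝ) + 1)) ^ 3 := by positivity
    push_cast
    calc ((((t : ℝ)) ^ s)⁻¹ - (((t : ℝ) + 1) ^ s)⁻¹) * (2 * ((t : ℝ) + 1)) ^ 3
        ≤ (s * ((t : ℝ) ^ (s + 1))⁻¹) * (2 * ((t : ℝ) + 1)) ^ 3 := mul_le_mul_of_nonneg_right h1 h4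
      _ ≤ (s * ((t : ℝ) ^ (s + 1))⁻¹) * (64 * (t : ℝ) ^ 3) := mul_le_mul_of_nonneg_left h2 h3
      _ = 64 * s * ((t : ℝ) ^ 3 * (((t : ℝ)) ^ (s + 1))⁻¹) := by ring

/-! ## §3 The five sums -/

/-- ★★ `Σ_{z∈S} (tdist z y)⁻¹ ≤ 128·N²` (`S ⊆ {1 ≤ M ≤ tdist ≤ N}`, d = 3). [folklore] -/
theorem sum_inv_tdist_le (hd : P.d = 3) (S : Finset (Site P j)) (y : Site P j) {M N : ℕ} (hM : 1 ≤ M) (hMN : M ≤ N)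
    (hS : ∀ z ∈ S, M ≤ Site.tdist z y ∧ Site.tdist z y ≤ N) :
    ∑ z ∈ S, (((Site.tdist z y : ℕ) : ℝ))⁻¹ ≤ 128 * (N : ℝ) ^ 2 := by
  have h := sum_radial_inv_pow_le hd S y 1 hM hMN hS
  simp only [pow_one, Nat.cast_one, mul_one] at h
  have hN1 : (1 : ℝ) ≤ N := by exact_mod_cast hM.trans hMN
  have hN0 : (0 : ℝ) < N := by linarith
  have e1 : 64 * (N : ℝ) ^ 3 * ((N : ℝ))⁻¹ = 64 * (N : ℝ) ^ 2 := by field_simp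
  have h2 : ∑ t ∈ Ico M N, ((t : ℝ) ^ 3 * (((t : ℝ)) ^ 2)⁻¹) ≤ (N : ℝ) ^ 2 := by
    have h3 : ∀ t ∈ Ico M N, ((t : ℝ) ^ 3 * (((t : ℝ)) ^ 2)⁻¹) ≤ (N : ℝ) := by
      intro t ht
      rw [Finset.mem_Ico] at ht
      have ht0 : (0 : ℝ) < t := by exact_mod_cast hM.trans ht.1
      have htN : (t : ℝ) ≤ N := by exact_mod_cast ht.2.le
      rw [show (t : ℝ) ^ 3 * (((t : ℝ)) ^ 2)⁻¹ = (t : ℝ) by field_simp]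
      exact htN
    calc ∑ t ∈ Ico M N, ((t : ℝ) ^ 3 * (((t : ℝ)) ^ 2)⁻¹) ≤ ∑ _t ∈ Ico M N, (N : ℝ) := Finset.sum_le_sum h3
      _ = ((N - M : ℕ) : ℝ) * N := by rw [Finset.sum_const, Nat.card_Ico, nsmul_eq_mul]
      _ ≤ (N : ℝ) * N := by
          refine mul_le_mul_of_nonneg_right ?_ hN0.le
          exact_mod_cast Nat.sub_le N M
      _ = (N : ℝ) ^ 2 := by ring
  rw [e1] at h
  linarith

/-- ★★ `Σ_{z∈S} (tdist z y)⁻² ≤ 192·N` (d = 3). [folklore] -/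
theorem sum_inv_tdist_sq_le (hd : P.d = 3) (S : Finset (Site P j)) (y : Site P j) {M N : ℕ} (hM : 1 ≤ M) (hMN : M ≤ N)
    (hS : ∀ z ∈ S, M ≤ Site.tdist z y ∧ Site.tdist z y ≤ N) :
    ∑ z ∈ S, ((((Site.tdist z y : ℕ) : ℝ)) ^ 2)⁻¹ ≤ 192 * (N : ℝ) := by
  have h := sum_radial_inv_pow_le hd S y 2 hM hMN hS
  have hN1 : (1 : ℝ) ≤ N := by exact_mod_cast hM.trans hMN
  have hN0 : (0 : ℝ) < N := by linarith
  have e1 : 64 * (N : ℝ) ^ 3 * (((N : ℝ)) ^ 2)⁻¹ = 64 * (N : ℝ) := by field_simp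
  have h2 : ∑ t ∈ Ico M N, ((t : ℝ) ^ 3 * (((t : ℝ)) ^ 3)⁻¹) ≤ (N : ℝ) := by
    have h3 : ∀ t ∈ Ico M N, ((t : ℝ) ^ 3 * (((t : ℝ)) ^ 3)⁻¹) = 1 := by
      intro t ht
      rw [Finset.mem_Ico] at ht
      have ht0 : (0 : ℝ) < t := by exact_mod_cast hM.trans ht.1
      field_simp
    rw [Finset.sum_congr rfl h3, Finset.sum_const, Nat.card_Ico, nsmul_eq_mul, mul_one]
    have : ((N - M : ℕ) : ℝ) ≤ N := by exact_mod_cast Nat.sub_le N M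
    exact this
  rw [e1] at h
  push_cast at h
  linarith

/-- ★★ `Σ_{z∈S} (tdist z y)⁻³ ≤ 64 + 192·Σ_{t∈[M,N)} t⁻¹` (d = 3; the harmonic sum is kept explicit — the genuine logarithm). [folklore] -/
theorem sum_inv_tdist_cube_le (hd : P.d = 3) (S : Finset (Site P j)) (y : Site P j) {M N : ℕ} (hM : 1 ≤ M) (hMN : M ≤ N)
    (hS : ∀ z ∈ S, M ≤ Site.tdist z y ∧ Site.tdist z y ≤ N) :
    ∑ z ∈ S, ((((Site.tdist z y : ℕ) : ℝ)) ^ 3)⁻¹ ≤ 64 + 192 * ∑ t ∈ Ico M N, ((t : ℝ))⁻¹ := by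
  have h := sum_radial_inv_pow_le hd S y 3 hM hMN hS
  have hN1 : (1 : ℝ) ≤ N := by exact_mod_cast hM.trans hMN
  have hN0 : (0 : ℝ) < N := by linarith
  have e1 : 64 * (N : ℝ) ^ 3 * (((N : ℝ)) ^ 3)⁻¹ = 64 := by field_simp
  have h3 : ∀ t ∈ Ico M N, ((t : ℝ) ^ 3 * (((t : ℝ)) ^ 4)⁻¹) = ((t : ℝ))⁻¹ := by
    intro t ht
    rw [Finset.mem_Ico] at ht
    have ht0 : (0 : ℝ) < t := by exact_mod_cast hM.trans ht.1
    field_simp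
  rw [e1, Finset.sum_congr rfl h3] at h
  push_cast at h
  linarith

/-- `Σ_{t∈[M,N)} t⁻² ≤ 2∕M` for `1 ≤ M`. [folklore] -/
theorem sum_Ico_inv_sq_le {M N : ℕ} (hM : 1 ≤ M) : ∑ t ∈ Ico M N, (((t : ℝ)) ^ 2)⁻¹ ≤ 2 / M := by
  have hM0 : (0 : ℝ) < M := by exact_mod_cast hM
  by_cases hMN : M < N
  · rw [Finset.sum_eq_sum_Ico_succ_bot hMN]
    have h1 : ∑ t ∈ Ico (M + 1) N, (((t : ℝ)) ^ 2)⁻¹ ≤ (M : ℝ)⁻¹ := by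
      have hsub : Ico (M + 1) N ⊆ Ioc M N := fun t ht => by
        rw [Finset.mem_Ico] at ht; rw [Finset.mem_Ioc]; omega
      calc ∑ t ∈ Ico (M + 1) N, (((t : ℝ)) ^ 2)⁻¹ ≤ ∑ t ∈ Ioc M N, (((t : ℝ)) ^ 2)⁻¹ :=
            Finset.sum_le_sum_of_subset_of_nonneg hsub (fun t _ _ => by positivity)
        _ ≤ (M : ℝ)⁻¹ - (N : ℝ)⁻¹ := sum_Ioc_inv_sq_le_sub (by omega) hMN.le
        _ ≤ (M : ℝ)⁻¹ := by
            have : (0 : ℝ) ≤ (N : ℝ)⁻¹ := by positivity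
            linarith
    have hM1 : (1 : ℝ) ≤ M := by exact_mod_cast hM
    have h2 : (((M : ℝ)) ^ 2)⁻¹ ≤ (M : ℝ)⁻¹ := inv_anti₀ hM0 (by nlinarith)
    calc (((M : ℝ)) ^ 2)⁻¹ + ∑ t ∈ Ico (M + 1) N, (((t : ℝ)) ^ 2)⁻¹ ≤ (M : ℝ)⁻¹ + (M : ℝ)⁻¹ := add_le_add h2 h1
      _ = 2 / M := by ring
  · rw [Finset.Ico_eq_empty hMN, Finset.sum_empty]
    positivity

/-- ★ `Σ_{z∈S} (tdist z y)⁻⁴ ≤ 576∕M` (d = 3; the far-field tail). [folklore] -/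
theorem sum_inv_tdist_pow_four_le (hd : P.d = 3) (S : Finset (Site P j)) (y : Site P j) {M N : ℕ} (hM : 1 ≤ M) (hMN : M ≤ N)
    (hS : ∀ z ∈ S, M ≤ Site.tdist z y ∧ Site.tdist z y ≤ N) :
    ∑ z ∈ S, ((((Site.tdist z y : ℕ) : ℝ)) ^ 4)⁻¹ ≤ 576 / M := by
  have h := sum_radial_inv_pow_le hd S y 4 hM hMN hS
  have hM0 : (0 : ℝ) < M := by exact_mod_cast hM
  have hN1 : (M : ℝ) ≤ N := by exact_mod_cast hMN
  have hN0 : (0 : ℝ) < N := by linarith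
  have e1 : 64 * (N : ℝ) ^ 3 * (((N : ℝ)) ^ 4)⁻¹ = 64 / N := by field_simp
  have h3 : ∀ t ∈ Ico M N, ((t : ℝ) ^ 3 * (((t : ℝ)) ^ 5)⁻¹) = (((t : ℝ)) ^ 2)⁻¹ := by
    intro t ht
    rw [Finset.mem_Ico] at ht
    have ht0 : (0 : ℝ) < t := by exact_mod_cast hM.trans ht.1
    field_simp
  rw [e1, Finset.sum_congr rfl h3] at h
  have h4 := sum_Ico_inv_sq_le (N := N) hM
  have h5 : (64 : ℝ) / N ≤ 64 / M := div_le_div_of_nonneg_left (by norm_num) hM0 hN1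
  push_cast at h
  calc _ ≤ 64 / N + 64 * 4 * ∑ t ∈ Ico M N, (((t : ℝ)) ^ 2)⁻¹ := h
    _ ≤ 64 / M + 64 * 4 * (2 / M) := add_le_add h5 (mul_le_mul_of_nonneg_left h4 (by norm_num))
    _ = 576 / M := by ring

/-- ★ `Σ_{z∈S} (tdist z y)⁻⁵ ≤ 704∕M²` (d = 3). [folklore] -/
theorem sum_inv_tdist_pow_five_le (hd : P.d = 3) (S : Finset (Site P j)) (y : Site P j) {M N : ℕ} (hM : 1 ≤ M) (hMN : M ≤ N)
    (hS : ∀ z ∈ S, M ≤ Site.tdist z y ∧ Site.tdist z y ≤ N) :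
    ∑ z ∈ S, ((((Site.tdist z y : ℕ) : ℝ)) ^ 5)⁻¹ ≤ 704 / (M : ℝ) ^ 2 := by
  have h := sum_radial_inv_pow_le hd S y 5 hM hMN hS
  have hM0 : (0 : ℝ) < M := by exact_mod_cast hM
  have hM1 : (1 : ℝ) ≤ M := by exact_mod_cast hM
  have hN1 : (M : ℝ) ≤ N := by exact_mod_cast hMN
  have hN0 : (0 : ℝ) < N := by linarith
  have e1 : 64 * (N : ℝ) ^ 3 * (((N : ℝ)) ^ 5)⁻¹ = 64 / (N : ℝ) ^ 2 := by field_simp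
  have h3 : ∀ t ∈ Ico M N, ((t : ℝ) ^ 3 * (((t : ℝ)) ^ 6)⁻¹) ≤ (M : ℝ)⁻¹ * (((t : ℝ)) ^ 2)⁻¹ := by
    intro t ht
    rw [Finset.mem_Ico] at ht
    have ht0 : (M : ℝ) ≤ t := by exact_mod_cast ht.1
    have ht1 : (0 : ℝ) < t := by linarith
    rw [show (t : ℝ) ^ 3 * (((t : ℝ)) ^ 6)⁻¹ = ((t : ℝ))⁻¹ * (((t : ℝ)) ^ 2)⁻¹ by field_simp]
    exact mul_le_mul_of_nonneg_right (inv_anti₀ hM0 ht0) (by positivity)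
  rw [e1] at h
  have h4 : ∑ t ∈ Ico M N, ((t : ℝ) ^ 3 * (((t : ℝ)) ^ (5 + 1))⁻¹) ≤ (M : ℝ)⁻¹ * (2 / M) := by
    calc ∑ t ∈ Ico M N, ((t : ℝ) ^ 3 * (((t : ℝ)) ^ (5 + 1))⁻¹) ≤ ∑ t ∈ Ico M N, (M : ℝ)⁻¹ * (((t : ℝ)) ^ 2)⁻¹ := Finset.sum_le_sum h3
      _ = (M : ℝ)⁻¹ * ∑ t ∈ Ico M N, (((t : ℝ)) ^ 2)⁻¹ := by rw [Finset.mul_sum]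
      _ ≤ (M : ℝ)⁻¹ * (2 / M) := mul_le_mul_of_nonneg_left (sum_Ico_inv_sq_le hM) (by positivity)
  have h5 : (64 : ℝ) / (N : ℝ) ^ 2 ≤ 64 / (M : ℝ) ^ 2 := div_le_div_of_nonneg_left (by norm_num) (by positivity) (pow_le_pow_left₀ hM0.le hN1 2)
  push_cast at h
  calc _ ≤ 64 / (N : ℝ) ^ 2 + 64 * 5 * ∑ t ∈ Ico M N, ((t : ℝ) ^ 3 * (((t : ℝ)) ^ (5 + 1))⁻¹) := h
    _ ≤ 64 / (M : ℝ) ^ 2 + 64 * 5 * ((M : ℝ)⁻¹ * (2 / M)) := add_le_add h5 (mul_le_mul_of_nonneg_left h4 (by norm_num))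
    _ = 704 / (M : ℝ) ^ 2 := by field_simp; ring

end Summit.QuantumFields.YangMills.Theorems.Prop7TorusRadialSums

end
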